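import Summits.Ventures.PercRepro2.CaseOneGlue

/-!
# Gluing faces, the marks: `o`, `b` and the statement vertex `a₃` move along an edge of weight one
(blind cell PercRepro2, p1 g17; S5 (S5.a″) (n): the remaining index-`3` faces)

`CaseOneGlue.lean` moves a ROOT along an edge of weight `1`. The same congruences move the marks `o`,
`b` and the statement vertex `a₃` (`iiExprT_glue_o`, `iiExprT_glue_b`, `iiExprT_glue_a3`, the `(i)`
twins, `Dpdo_glue_o`, `Dqo_glue_o`, `Dpd_glue_a3`, `Dpdo_glue_a3`, and the Props
`zSplitII_glue_o` …). Composed with `CaseOneDegenerate.lean` (in `CaseOneMarkGlued.lean`) this closes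
every face on which a gadget edge joins `a₃` to a mark with weight `1`. Own code; standard axioms. -/

set_option linter.unusedSimpArgs false

namespace Summit.Ventures.PercRepro2

namespace CaseOne

section MarkGlue
variable {V : Type*} {E : Type*} [Fintype E] [DecidableEq E] {R : Type*} [CommRing R]
variable {ends : E → Sym2 V} {e : E} {p : E → R}

/-- `D_o` with the mark `o` moved to `w`. -/
theorem Dpdo_glue_o (he : p e = 1) {o w : V} (hends : ends e = s(o, w)) (a₁ a₂ a₃ : V) :
    Dpdo p ends o a₁ a₂ a₃ = Dpdo p ends w a₁ a₂ a₃ := by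
  unfold Dpdo
  exact prob_congr_of_open p he fun ω hω => by
    simp only [Set.mem_inter_iff, Set.mem_union, Set.mem_compl_iff, mem_connEvent,
      conn_swap_left hω hends, conn_swap_right hω hends]

/-- `P(Q, o ∈ U)` with the mark `o` moved to `w`. -/
theorem Dqo_glue_o (he : p e = 1) {o w : V} (hends : ends e = s(o, w)) (a₁ a₂ : V) :
    Dqo p ends o a₁ a₂ = Dqo p ends w a₁ a₂ := by
  unfold Dqo
  exact prob_congr_of_open p he fun ω hω => by
    simp only [Set.mem_inter_iff, Set.mem_union, Set.mem_compl_iff, mem_connEvent,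
      conn_swap_left hω hends, conn_swap_right hω hends]

/-- `D` with the statement vertex `a₃` moved to `w`. -/
theorem Dpd_glue_a3 (he : p e = 1) {a₃ w : V} (hends : ends e = s(a₃, w)) (a₁ a₂ : V) :
    Dpd p ends a₁ a₂ a₃ = Dpd p ends a₁ a₂ w := by
  unfold Dpd
  exact prob_congr_of_open p he fun ω hω => by
    simp only [Set.mem_inter_iff, Set.mem_union, Set.mem_compl_iff, mem_connEvent,
      conn_swap_left hω hends, conn_swap_right hω hends]

/-- `D_o` with the statement vertex `a₃` moved to `w`. -/
theorem Dpdo_glue_a3 (he : p e = 1) {a₃ w : V} (hends : ends e = s(a₃, w)) (o a₁ a₂ : V) :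
    Dpdo p ends o a₁ a₂ a₃ = Dpdo p ends o a₁ a₂ w := by
  unfold Dpdo
  exact prob_congr_of_open p he fun ω hω => by
    simp only [Set.mem_inter_iff, Set.mem_union, Set.mem_compl_iff, mem_connEvent,
      conn_swap_left hω hends, conn_swap_right hω hends]

/-- `iiExprT` with the mark `o` moved to `w` (any threshold pair). -/
theorem iiExprT_glue_o (he : p e = 1) {o w : V} (hends : ends e = s(o, w)) (a₁ a₂ a₃ b : V)
    (c₀ c₁ : R) : iiExprT p ends o a₁ a₂ a₃ b c₀ c₁ = iiExprT p ends w a₁ a₂ a₃ b c₀ c₁ := by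
  rw [iiExprT_eq, iiExprT_eq]
  have h1 : prob p (connEvent ends a₂ b ∩ connEvent ends a₁ a₃ ∩ connEvent ends a₂ o ∩
      (connEvent ends a₁ a₂)ᶜ) =
      prob p (connEvent ends a₂ b ∩ connEvent ends a₁ a₃ ∩ connEvent ends a₂ w ∩
      (connEvent ends a₁ a₂)ᶜ) :=
    prob_congr_of_open p he fun ω hω => by
      simp only [Set.mem_inter_iff, Set.mem_compl_iff, mem_connEvent, conn_swap_left hω hends,
        conn_swap_right hω hends]
  have h2 : prob p (connEvent ends a₂ b ∩ (connEvent ends a₁ a₂)ᶜ) =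
      prob p (connEvent ends a₂ b ∩ (connEvent ends a₁ a₂)ᶜ) :=
    prob_congr_of_open p he fun ω hω => by
      simp only [Set.mem_inter_iff, Set.mem_compl_iff, mem_connEvent, conn_swap_left hω hends,
        conn_swap_right hω hends]
  have h3 : prob p (connEvent ends a₁ a₃ ∩ connEvent ends a₂ o ∩ (connEvent ends a₁ a₂)ᶜ) =
      prob p (connEvent ends a₁ a₃ ∩ connEvent ends a₂ w ∩ (connEvent ends a₁ a₂)ᶜ) :=
    prob_congr_of_open p he fun ω hω => by
      simp only [Set.mem_inter_iff, Set.mem_compl_iff, mem_connEvent, conn_swap_left hω hends,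
        conn_swap_right hω hends]
  have h4 : prob p (connEvent ends a₂ b ∩ connEvent ends a₁ a₃ ∩ (connEvent ends a₁ a₂)ᶜ) =
      prob p (connEvent ends a₂ b ∩ connEvent ends a₁ a₃ ∩ (connEvent ends a₁ a₂)ᶜ) :=
    prob_congr_of_open p he fun ω hω => by
      simp only [Set.mem_inter_iff, Set.mem_compl_iff, mem_connEvent, conn_swap_left hω hends,
        conn_swap_right hω hends]
  have h5 : prob p (connEvent ends a₁ a₃ ∩ (connEvent ends a₁ a₂)ᶜ) =
      prob p (connEvent ends a₁ a₃ ∩ (connEvent ends a₁ a₂)ᶜ) :=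
    prob_congr_of_open p he fun ω hω => by
      simp only [Set.mem_inter_iff, Set.mem_compl_iff, mem_connEvent, conn_swap_left hω hends,
        conn_swap_right hω hends]
  rw [h1, h2, h3, h4, h5]

/-- `iExprT` with the mark `o` moved to `w` (any threshold pair). -/
theorem iExprT_glue_o (he : p e = 1) {o w : V} (hends : ends e = s(o, w)) (a₁ a₂ a₃ b : V)
    (c₀ c₁ : R) : iExprT p ends o a₁ a₂ a₃ b c₀ c₁ = iExprT p ends w a₁ a₂ a₃ b c₀ c₁ := by
  rw [iExprT_eq, iExprT_eq]
  have h1 : prob p (connEvent ends a₁ b ∩ connEvent ends a₁ a₃ ∩ connEvent ends a₂ o ∩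
      (connEvent ends a₁ a₂)ᶜ) =
      prob p (connEvent ends a₁ b ∩ connEvent ends a₁ a₃ ∩ connEvent ends a₂ w ∩
      (connEvent ends a₁ a₂)ᶜ) :=
    prob_congr_of_open p he fun ω hω => by
      simp only [Set.mem_inter_iff, Set.mem_compl_iff, mem_connEvent, conn_swap_left hω hends,
        conn_swap_right hω hends]
  have h2 : prob p (connEvent ends a₁ b ∩ (connEvent ends a₁ a₂)ᶜ) =
      prob p (connEvent ends a₁ b ∩ (connEvent ends a₁ a₂)ᶜ) :=
    prob_congr_of_open p he fun ω hω => by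
      simp only [Set.mem_inter_iff, Set.mem_compl_iff, mem_connEvent, conn_swap_left hω hends,
        conn_swap_right hω hends]
  have h3 : prob p (connEvent ends a₁ a₃ ∩ connEvent ends a₂ o ∩ (connEvent ends a₁ a₂)ᶜ) =
      prob p (connEvent ends a₁ a₃ ∩ connEvent ends a₂ w ∩ (connEvent ends a₁ a₂)ᶜ) :=
    prob_congr_of_open p he fun ω hω => by
      simp only [Set.mem_inter_iff, Set.mem_compl_iff, mem_connEvent, conn_swap_left hω hends,
        conn_swap_right hω hends]
  have h4 : prob p (connEvent ends a₁ b ∩ connEvent ends a₁ a₃ ∩ (connEvent ends a₁ a₂)ᶜ) =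
      prob p (connEvent ends a₁ b ∩ connEvent ends a₁ a₃ ∩ (connEvent ends a₁ a₂)ᶜ) :=
    prob_congr_of_open p he fun ω hω => by
      simp only [Set.mem_inter_iff, Set.mem_compl_iff, mem_connEvent, conn_swap_left hω hends,
        conn_swap_right hω hends]
  have h5 : prob p (connEvent ends a₁ a₃ ∩ (connEvent ends a₁ a₂)ᶜ) =
      prob p (connEvent ends a₁ a₃ ∩ (connEvent ends a₁ a₂)ᶜ) :=
    prob_congr_of_open p he fun ω hω => by
      simp only [Set.mem_inter_iff, Set.mem_compl_iff, mem_connEvent, conn_swap_left hω hends,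
        conn_swap_right hω hends]
  rw [h1, h2, h3, h4, h5]

/-- `iiExprT` with the mark `b` moved to `w` (any threshold pair). -/
theorem iiExprT_glue_b (he : p e = 1) {b w : V} (hends : ends e = s(b, w)) (o a₁ a₂ a₃ : V)
    (c₀ c₁ : R) : iiExprT p ends o a₁ a₂ a₃ b c₀ c₁ = iiExprT p ends o a₁ a₂ a₃ w c₀ c₁ := by
  rw [iiExprT_eq, iiExprT_eq]
  have h1 : prob p (connEvent ends a₂ b ∩ connEvent ends a₁ a₃ ∩ connEvent ends a₂ o ∩
      (connEvent ends a₁ a₂)ᶜ) =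
      prob p (connEvent ends a₂ w ∩ connEvent ends a₁ a₃ ∩ connEvent ends a₂ o ∩
      (connEvent ends a₁ a₂)ᶜ) :=
    prob_congr_of_open p he fun ω hω => by
      simp only [Set.mem_inter_iff, Set.mem_compl_iff, mem_connEvent, conn_swap_left hω hends,
        conn_swap_right hω hends]
  have h2 : prob p (connEvent ends a₂ b ∩ (connEvent ends a₁ a₂)ᶜ) =
      prob p (connEvent ends a₂ w ∩ (connEvent ends a₁ a₂)ᶜ) :=
    prob_congr_of_open p he fun ω hω => by
      simp only [Set.mem_inter_iff, Set.mem_compl_iff, mem_connEvent, conn_swap_left hω hends,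
        conn_swap_right hω hends]
  have h3 : prob p (connEvent ends a₁ a₃ ∩ connEvent ends a₂ o ∩ (connEvent ends a₁ a₂)ᶜ) =
      prob p (connEvent ends a₁ a₃ ∩ connEvent ends a₂ o ∩ (connEvent ends a₁ a₂)ᶜ) :=
    prob_congr_of_open p he fun ω hω => by
      simp only [Set.mem_inter_iff, Set.mem_compl_iff, mem_connEvent, conn_swap_left hω hends,
        conn_swap_right hω hends]
  have h4 : prob p (connEvent ends a₂ b ∩ connEvent ends a₁ a₃ ∩ (connEvent ends a₁ a₂)ᶜ) =
      prob p (connEvent ends a₂ w ∩ connEvent ends a₁ a₃ ∩ (connEvent ends a₁ a₂)ᶜ) :=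
    prob_congr_of_open p he fun ω hω => by
      simp only [Set.mem_inter_iff, Set.mem_compl_iff, mem_connEvent, conn_swap_left hω hends,
        conn_swap_right hω hends]
  have h5 : prob p (connEvent ends a₁ a₃ ∩ (connEvent ends a₁ a₂)ᶜ) =
      prob p (connEvent ends a₁ a₃ ∩ (connEvent ends a₁ a₂)ᶜ) :=
    prob_congr_of_open p he fun ω hω => by
      simp only [Set.mem_inter_iff, Set.mem_compl_iff, mem_connEvent, conn_swap_left hω hends,
        conn_swap_right hω hends]
  rw [h1, h2, h3, h4, h5]

/-- `iExprT` with the mark `b` moved to `w` (any threshold pair). -/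
theorem iExprT_glue_b (he : p e = 1) {b w : V} (hends : ends e = s(b, w)) (o a₁ a₂ a₃ : V)
    (c₀ c₁ : R) : iExprT p ends o a₁ a₂ a₃ b c₀ c₁ = iExprT p ends o a₁ a₂ a₃ w c₀ c₁ := by
  rw [iExprT_eq, iExprT_eq]
  have h1 : prob p (connEvent ends a₁ b ∩ connEvent ends a₁ a₃ ∩ connEvent ends a₂ o ∩
      (connEvent ends a₁ a₂)ᶜ) =
      prob p (connEvent ends a₁ w ∩ connEvent ends a₁ a₃ ∩ connEvent ends a₂ o ∩
      (connEvent ends a₁ a₂)ᶜ) :=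
    prob_congr_of_open p he fun ω hω => by
      simp only [Set.mem_inter_iff, Set.mem_compl_iff, mem_connEvent, conn_swap_left hω hends,
        conn_swap_right hω hends]
  have h2 : prob p (connEvent ends a₁ b ∩ (connEvent ends a₁ a₂)ᶜ) =
      prob p (connEvent ends a₁ w ∩ (connEvent ends a₁ a₂)ᶜ) :=
    prob_congr_of_open p he fun ω hω => by
      simp only [Set.mem_inter_iff, Set.mem_compl_iff, mem_connEvent, conn_swap_left hω hends,
        conn_swap_right hω hends]
  have h3 : prob p (connEvent ends a₁ a₃ ∩ connEvent ends a₂ o ∩ (connEvent ends a₁ a₂)ᶜ) =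
      prob p (connEvent ends a₁ a₃ ∩ connEvent ends a₂ o ∩ (connEvent ends a₁ a₂)ᶜ) :=
    prob_congr_of_open p he fun ω hω => by
      simp only [Set.mem_inter_iff, Set.mem_compl_iff, mem_connEvent, conn_swap_left hω hends,
        conn_swap_right hω hends]
  have h4 : prob p (connEvent ends a₁ b ∩ connEvent ends a₁ a₃ ∩ (connEvent ends a₁ a₂)ᶜ) =
      prob p (connEvent ends a₁ w ∩ connEvent ends a₁ a₃ ∩ (connEvent ends a₁ a₂)ᶜ) :=
    prob_congr_of_open p he fun ω hω => by
      simp only [Set.mem_inter_iff, Set.mem_compl_iff, mem_connEvent, conn_swap_left hω hends,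
        conn_swap_right hω hends]
  have h5 : prob p (connEvent ends a₁ a₃ ∩ (connEvent ends a₁ a₂)ᶜ) =
      prob p (connEvent ends a₁ a₃ ∩ (connEvent ends a₁ a₂)ᶜ) :=
    prob_congr_of_open p he fun ω hω => by
      simp only [Set.mem_inter_iff, Set.mem_compl_iff, mem_connEvent, conn_swap_left hω hends,
        conn_swap_right hω hends]
  rw [h1, h2, h3, h4, h5]

/-- `iiExprT` with the statement vertex `a₃` moved to `w` (any threshold pair). -/
theorem iiExprT_glue_a3 (he : p e = 1) {a₃ w : V} (hends : ends e = s(a₃, w)) (o a₁ a₂ b : V)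
    (c₀ c₁ : R) : iiExprT p ends o a₁ a₂ a₃ b c₀ c₁ = iiExprT p ends o a₁ a₂ w b c₀ c₁ := by
  rw [iiExprT_eq, iiExprT_eq]
  have h1 : prob p (connEvent ends a₂ b ∩ connEvent ends a₁ a₃ ∩ connEvent ends a₂ o ∩
      (connEvent ends a₁ a₂)ᶜ) =
      prob p (connEvent ends a₂ b ∩ connEvent ends a₁ w ∩ connEvent ends a₂ o ∩
      (connEvent ends a₁ a₂)ᶜ) :=
    prob_congr_of_open p he fun ω hω => by
      simp only [Set.mem_inter_iff, Set.mem_compl_iff, mem_connEvent, conn_swap_left hω hends,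
        conn_swap_right hω hends]
  have h2 : prob p (connEvent ends a₂ b ∩ (connEvent ends a₁ a₂)ᶜ) =
      prob p (connEvent ends a₂ b ∩ (connEvent ends a₁ a₂)ᶜ) :=
    prob_congr_of_open p he fun ω hω => by
      simp only [Set.mem_inter_iff, Set.mem_compl_iff, mem_connEvent, conn_swap_left hω hends,
        conn_swap_right hω hends]
  have h3 : prob p (connEvent ends a₁ a₃ ∩ connEvent ends a₂ o ∩ (connEvent ends a₁ a₂)ᶜ) =
      prob p (connEvent ends a₁ w ∩ connEvent ends a₂ o ∩ (connEvent ends a₁ a₂)ᶜ) :=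
    prob_congr_of_open p he fun ω hω => by
      simp only [Set.mem_inter_iff, Set.mem_compl_iff, mem_connEvent, conn_swap_left hω hends,
        conn_swap_right hω hends]
  have h4 : prob p (connEvent ends a₂ b ∩ connEvent ends a₁ a₃ ∩ (connEvent ends a₁ a₂)ᶜ) =
      prob p (connEvent ends a₂ b ∩ connEvent ends a₁ w ∩ (connEvent ends a₁ a₂)ᶜ) :=
    prob_congr_of_open p he fun ω hω => by
      simp only [Set.mem_inter_iff, Set.mem_compl_iff, mem_connEvent, conn_swap_left hω hends,
        conn_swap_right hω hends]
  have h5 : prob p (connEvent ends a₁ a₃ ∩ (connEvent ends a₁ a₂)ᶜ) =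
      prob p (connEvent ends a₁ w ∩ (connEvent ends a₁ a₂)ᶜ) :=
    prob_congr_of_open p he fun ω hω => by
      simp only [Set.mem_inter_iff, Set.mem_compl_iff, mem_connEvent, conn_swap_left hω hends,
        conn_swap_right hω hends]
  rw [h1, h2, h3, h4, h5]

/-- `iExprT` with the statement vertex `a₃` moved to `w` (any threshold pair). -/
theorem iExprT_glue_a3 (he : p e = 1) {a₃ w : V} (hends : ends e = s(a₃, w)) (o a₁ a₂ b : V)
    (c₀ c₁ : R) : iExprT p ends o a₁ a₂ a₃ b c₀ c₁ = iExprT p ends o a₁ a₂ w b c₀ c₁ := by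
  rw [iExprT_eq, iExprT_eq]
  have h1 : prob p (connEvent ends a₁ b ∩ connEvent ends a₁ a₃ ∩ connEvent ends a₂ o ∩
      (connEvent ends a₁ a₂)ᶜ) =
      prob p (connEvent ends a₁ b ∩ connEvent ends a₁ w ∩ connEvent ends a₂ o ∩
      (connEvent ends a₁ a₂)ᶜ) :=
    prob_congr_of_open p he fun ω hω => by
      simp only [Set.mem_inter_iff, Set.mem_compl_iff, mem_connEvent, conn_swap_left hω hends,
        conn_swap_right hω hends]
  have h2 : prob p (connEvent ends a₁ b ∩ (connEvent ends a₁ a₂)ᶜ) =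
      prob p (connEvent ends a₁ b ∩ (connEvent ends a₁ a₂)ᶜ) :=
    prob_congr_of_open p he fun ω hω => by
      simp only [Set.mem_inter_iff, Set.mem_compl_iff, mem_connEvent, conn_swap_left hω hends,
        conn_swap_right hω hends]
  have h3 : prob p (connEvent ends a₁ a₃ ∩ connEvent ends a₂ o ∩ (connEvent ends a₁ a₂)ᶜ) =
      prob p (connEvent ends a₁ w ∩ connEvent ends a₂ o ∩ (connEvent ends a₁ a₂)ᶜ) :=
    prob_congr_of_open p he fun ω hω => by
      simp only [Set.mem_inter_iff, Set.mem_compl_iff, mem_connEvent, conn_swap_left hω hends,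
        conn_swap_right hω hends]
  have h4 : prob p (connEvent ends a₁ b ∩ connEvent ends a₁ a₃ ∩ (connEvent ends a₁ a₂)ᶜ) =
      prob p (connEvent ends a₁ b ∩ connEvent ends a₁ w ∩ (connEvent ends a₁ a₂)ᶜ) :=
    prob_congr_of_open p he fun ω hω => by
      simp only [Set.mem_inter_iff, Set.mem_compl_iff, mem_connEvent, conn_swap_left hω hends,
        conn_swap_right hω hends]
  have h5 : prob p (connEvent ends a₁ a₃ ∩ (connEvent ends a₁ a₂)ᶜ) =
      prob p (connEvent ends a₁ w ∩ (connEvent ends a₁ a₂)ᶜ) :=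
    prob_congr_of_open p he fun ω hω => by
      simp only [Set.mem_inter_iff, Set.mem_compl_iff, mem_connEvent, conn_swap_left hω hends,
        conn_swap_right hω hends]
  rw [h1, h2, h3, h4, h5]

/-- `iiExpr` with the mark `o` moved to `w`. -/
theorem iiExpr_glue_o (he : p e = 1) {o w : V} (hends : ends e = s(o, w)) (a₁ a₂ a₃ b : V) :
    iiExpr p ends o a₁ a₂ a₃ b = iiExpr p ends w a₁ a₂ a₃ b := by
  rw [iiExpr_eq_iiExprT, iiExpr_eq_iiExprT, Dpdo_glue_o he hends, iiExprT_glue_o he hends]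

/-- `iExpr` with the mark `o` moved to `w`. -/
theorem iExpr_glue_o (he : p e = 1) {o w : V} (hends : ends e = s(o, w)) (a₁ a₂ a₃ b : V) :
    iExpr p ends o a₁ a₂ a₃ b = iExpr p ends w a₁ a₂ a₃ b := by
  rw [iExpr_eq_iExprT, iExpr_eq_iExprT, Dpdo_glue_o he hends, iExprT_glue_o he hends]

/-- `iiExpr` with the mark `b` moved to `w`. -/
theorem iiExpr_glue_b (he : p e = 1) {b w : V} (hends : ends e = s(b, w)) (o a₁ a₂ a₃ : V) :
    iiExpr p ends o a₁ a₂ a₃ b = iiExpr p ends o a₁ a₂ a₃ w := by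
  rw [iiExpr_eq_iiExprT, iiExpr_eq_iiExprT, iiExprT_glue_b he hends]

/-- `iExpr` with the mark `b` moved to `w`. -/
theorem iExpr_glue_b (he : p e = 1) {b w : V} (hends : ends e = s(b, w)) (o a₁ a₂ a₃ : V) :
    iExpr p ends o a₁ a₂ a₃ b = iExpr p ends o a₁ a₂ a₃ w := by
  rw [iExpr_eq_iExprT, iExpr_eq_iExprT, iExprT_glue_b he hends]

/-- `iiExpr` with the statement vertex `a₃` moved to `w`. -/
theorem iiExpr_glue_a3 (he : p e = 1) {a₃ w : V} (hends : ends e = s(a₃, w)) (o a₁ a₂ b : V) :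
    iiExpr p ends o a₁ a₂ a₃ b = iiExpr p ends o a₁ a₂ w b := by
  rw [iiExpr_eq_iiExprT, iiExpr_eq_iiExprT, Dpdo_glue_a3 he hends, Dpd_glue_a3 he hends,
    iiExprT_glue_a3 he hends]

/-- `iExpr` with the statement vertex `a₃` moved to `w`. -/
theorem iExpr_glue_a3 (he : p e = 1) {a₃ w : V} (hends : ends e = s(a₃, w)) (o a₁ a₂ b : V) :
    iExpr p ends o a₁ a₂ a₃ b = iExpr p ends o a₁ a₂ w b := by
  rw [iExpr_eq_iExprT, iExpr_eq_iExprT, Dpdo_glue_a3 he hends, Dpd_glue_a3 he hends,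
    iExprT_glue_a3 he hends]

end MarkGlue

section MarkGlueProps
variable {V : Type*} {E : Type*} [Fintype E] [DecidableEq E] {R : Type*} [CommRing R]
  [LinearOrder R]
variable {ends : E → Sym2 V} {e : E} {p : E → R}

/-- `(ii)` is unchanged when the mark `o` moves to `w`. -/
theorem zSplitII_glue_o (he : p e = 1) {o w : V} (hends : ends e = s(o, w)) (a₁ a₂ a₃ b : V) :
    ZSplitII p ends o a₁ a₂ a₃ b ↔ ZSplitII p ends w a₁ a₂ a₃ b := by
  unfold ZSplitII; rw [iiExpr_glue_o he hends]

/-- `(i)` is unchanged when the mark `o` moves to `w`. -/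
theorem zSplitI_glue_o (he : p e = 1) {o w : V} (hends : ends e = s(o, w)) (a₁ a₂ a₃ b : V) :
    ZSplitI p ends o a₁ a₂ a₃ b ↔ ZSplitI p ends w a₁ a₂ a₃ b := by
  unfold ZSplitI; rw [iExpr_glue_o he hends]

/-- `(ii-Q)` is unchanged when the mark `o` moves to `w`. -/
theorem zSplitIIQ_glue_o (he : p e = 1) {o w : V} (hends : ends e = s(o, w)) (a₁ a₂ a₃ b : V) :
    ZSplitIIQ p ends o a₁ a₂ a₃ b ↔ ZSplitIIQ p ends w a₁ a₂ a₃ b := by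
  unfold ZSplitIIQ; rw [Dqo_glue_o he hends, iiExprT_glue_o he hends]

/-- `(i-Q)` is unchanged when the mark `o` moves to `w`. -/
theorem zSplitIQ_glue_o (he : p e = 1) {o w : V} (hends : ends e = s(o, w)) (a₁ a₂ a₃ b : V) :
    ZSplitIQ p ends o a₁ a₂ a₃ b ↔ ZSplitIQ p ends w a₁ a₂ a₃ b := by
  unfold ZSplitIQ; rw [Dqo_glue_o he hends, iExprT_glue_o he hends]

/-- `(ii)` is unchanged when the mark `b` moves to `w`. -/
theorem zSplitII_glue_b (he : p e = 1) {b w : V} (hends : ends e = s(b, w)) (o a₁ a₂ a₃ : V) :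
    ZSplitII p ends o a₁ a₂ a₃ b ↔ ZSplitII p ends o a₁ a₂ a₃ w := by
  unfold ZSplitII; rw [iiExpr_glue_b he hends]

/-- `(i)` is unchanged when the mark `b` moves to `w`. -/
theorem zSplitI_glue_b (he : p e = 1) {b w : V} (hends : ends e = s(b, w)) (o a₁ a₂ a₃ : V) :
    ZSplitI p ends o a₁ a₂ a₃ b ↔ ZSplitI p ends o a₁ a₂ a₃ w := by
  unfold ZSplitI; rw [iExpr_glue_b he hends]

/-- `(ii-Q)` is unchanged when the mark `b` moves to `w`. -/
theorem zSplitIIQ_glue_b (he : p e = 1) {b w : V} (hends : ends e = s(b, w)) (o a₁ a₂ a₃ : V) :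
    ZSplitIIQ p ends o a₁ a₂ a₃ b ↔ ZSplitIIQ p ends o a₁ a₂ a₃ w := by
  unfold ZSplitIIQ; rw [iiExprT_glue_b he hends]

/-- `(i-Q)` is unchanged when the mark `b` moves to `w`. -/
theorem zSplitIQ_glue_b (he : p e = 1) {b w : V} (hends : ends e = s(b, w)) (o a₁ a₂ a₃ : V) :
    ZSplitIQ p ends o a₁ a₂ a₃ b ↔ ZSplitIQ p ends o a₁ a₂ a₃ w := by
  unfold ZSplitIQ; rw [iExprT_glue_b he hends]

/-- `(ii)` is unchanged when the statement vertex `a₃` moves to `w`. -/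
theorem zSplitII_glue_a3 (he : p e = 1) {a₃ w : V} (hends : ends e = s(a₃, w)) (o a₁ a₂ b : V) :
    ZSplitII p ends o a₁ a₂ a₃ b ↔ ZSplitII p ends o a₁ a₂ w b := by
  unfold ZSplitII; rw [iiExpr_glue_a3 he hends]

/-- `(i)` is unchanged when the statement vertex `a₃` moves to `w`. -/
theorem zSplitI_glue_a3 (he : p e = 1) {a₃ w : V} (hends : ends e = s(a₃, w)) (o a₁ a₂ b : V) :
    ZSplitI p ends o a₁ a₂ a₃ b ↔ ZSplitI p ends o a₁ a₂ w b := by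
  unfold ZSplitI; rw [iExpr_glue_a3 he hends]

/-- `(ii-Q)` is unchanged when the statement vertex `a₃` moves to `w`. -/
theorem zSplitIIQ_glue_a3 (he : p e = 1) {a₃ w : V} (hends : ends e = s(a₃, w)) (o a₁ a₂ b : V) :
    ZSplitIIQ p ends o a₁ a₂ a₃ b ↔ ZSplitIIQ p ends o a₁ a₂ w b := by
  unfold ZSplitIIQ; rw [iiExprT_glue_a3 he hends]

/-- `(i-Q)` is unchanged when the statement vertex `a₃` moves to `w`. -/
theorem zSplitIQ_glue_a3 (he : p e = 1) {a₃ w : V} (hends : ends e = s(a₃, w)) (o a₁ a₂ b : V) :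
    ZSplitIQ p ends o a₁ a₂ a₃ b ↔ ZSplitIQ p ends o a₁ a₂ w b := by
  unfold ZSplitIQ; rw [iExprT_glue_a3 he hends]

end MarkGlueProps

end CaseOne

end Summit.Ventures.PercRepro2
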